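import Summits.ResolutionOfSingularities.ResolutionOfSingularities.Theorems.FrobeniusLadderFRationalResolutionMonoidAlgebraModel
import HarnessLib

/-!
# Crux `FrobeniusLadder.FRationalResolution` (stmt-ResolutionOfSingularities-15317), line `redirect`,
# stub `stub_diagonalizableQuotientResolution` — THE FIXED-POINT CONSUMER WITH A FIELD-UNIFORM MODEL CERTIFICATE
# (the «glue» open end of MEMO-15317-leafhand2-g25 §3, closed)

`…MonoidAlgebraModel.hasResolution_of_isolated_fixedPoints_of_monoidAlgebra_certificate` (p843485) takes, at each singular point,
the fixed-point data of a quotient chart together with a model-side certificate over the monoid algebra `κ(𝔮)[P]` of the weight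
kernel, `κ(𝔮)` being the residue field of the chart at the fixed prime. Class certificates
(`…ConeCertificateModel.modelCertificate_of_cone`, p843632) are proved UNIFORMLY in the field. This file states the consumer with the
model-side package quantified over ALL fields,

* ★★★★ `hasResolution_of_isolated_fixedPoints_of_fieldUniform_certificate`,

and instantiates it at `κ(𝔮)` inside the proof — so that a class-prover never writes a `κ(𝔮)`-typed term.

Lean note (the diagnosis of the `whnf` time-outs recorded in MEMO-15317-leafhand2-g25 §3, variants v1–v5): `obtain ⟨…⟩ := e` with `e`
an APPLICATION (`hchart t ht`, `hmodel κ(𝔮)`, `hcover t ht`) first runs `generalize`, whose type-correctness check of the abstracted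
goal — here the consumer's per-point existential over `κ(𝔮)[P]`, its blow-up algebras and their localizations — is what exceeds
any heartbeat budget. Binding the application with `have` and destructuring the resulting free variable skips `generalize`: the
proof below elaborates in seconds. Nothing mathematical happens in this file.

Honest label: assembly toward ONE leaf stub (no stub, crux or summit closed). No definitions, no named facts, no sorry.
[cite: Kato1994, Thm. (3.2)] [cite: Kollar2007, §2.2] [folklore; cite: CoxLittleSchenck2011, §1.1, §3.3]
-/

noncomputable section

-- single-problem summit: the doubled namespace component is forced
set_option linter.dupNamespace false

open CategoryTheory AlgebraicGeometry TopologicalSpace IsLocalRing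
open Literature.AlgebraicGeometry.Resolution

namespace Summit.ResolutionOfSingularities.ResolutionOfSingularities.Theorems.FRationalResolution.MonoidAlgebraModel

/-- The vertex ideal `𝔳_P = (χᵖ : 0 ≠ p ∈ P)` of the monoid algebra `κ[P]`. -/
local notation3 (prettyPrint := false) "𝕍[" κ ", " P "]" =>
  Ideal.span ((fun p : ↥P => AddMonoidAlgebra.single p (1 : κ)) '' {p : ↥P | p ≠ 0})

/-- ★★★★ **RESOLUTION OF VARIETIES WHOSE SINGULAR POINTS ARE ISOLATED FIXED POINTS OF QUOTIENT CHARTS CARRYING A FIELD-UNIFORM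
MONOID-ALGEBRA CERTIFICATE.** `X` integral, locally of finite type over a field, finitely many singular points; at each: an étale
quotient chart `Spec S₀ → X` (`S` of finite type over a field `k'`, graded by a torsion group `A`) hitting it at a `D(A)`-fixed prime `𝔔`
with homogeneous regular parameters `x` of weights `a` (`n = dim S_𝔔`), the weight kernel `P = {m : Σ mᵢ • aᵢ = 0} = ⟨G⟩` (`G` finite,
`0 ∉ G`), and — FOR EVERY FIELD `κ` — in the monoid algebra `κ[P]` with vertex ideal `𝔳`: generators `xv` of `𝔳^{b+1}`, a reduction
`y` of it (`(𝔳^{b+1})^{N+1} ⊆ (y)(𝔳^{b+1})^N`), and on each chart `C = κ[P][𝔳^{b+1}/yⱼ]` a set `G'` with every `C[1/g]` regular, a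
maximal `𝔪` and `M` with `𝔪^M ⊆ 𝔳C + (G')` and — if `C_𝔪` is singular — the regularity of `Bl_𝔪(Spec C_𝔪)`. Then `X` has a resolution of
singularities. (The package is used at `κ = κ(𝔮)`, the residue field of `(S₀)_𝔮`, `𝔮 = 𝔔 ∩ S₀`; p843485 does the rest.)
[cite: Kato1994, Thm. (3.2)] [cite: Kollar2007, §2.2] [folklore; cite: CoxLittleSchenck2011, §1.1, §3.3] -/
theorem hasResolution_of_isolated_fixedPoints_of_fieldUniform_certificate (k : Type) [Field k] (X : Scheme.{0}) [IsIntegral X]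
    (f : X ⟶ Spec (.of k)) [LocallyOfFiniteType f] (hfin : (Scheme.regularLocus X)ᶜ.Finite)
    (hchart : ∀ t : X, t ∉ Scheme.regularLocus X →
      ∃ (k' : Type) (_ : Field k') (A : Type) (_ : DecidableEq A) (_ : AddCommGroup A) (_ : AddMonoid.IsTorsion A)
        (S : Type) (_ : CommRing S) (_ : Algebra k' S) (𝒮 : A → Submodule k' S) (_ : GradedAlgebra 𝒮)
        (_ : Algebra.FiniteType k' S) (φ : Spec (.of (𝒮 0)) ⟶ X) (_ : Etale φ)
        (𝔔 : Ideal S) (_ : 𝔔.IsPrime) (_ : ∀ a : A, a ≠ 0 → ∀ s ∈ 𝒮 a, s ∈ 𝔔)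
        (n : ℕ) (x : Fin n → S) (a : Fin n → A) (P : AddSubmonoid (Fin n →₀ ℕ))
        (_ : ∀ i, x i ∈ 𝔔 ∧ x i ∈ 𝒮 (a i))
        (_ : Ideal.span (algebraMap S (Localization.AtPrime 𝔔) '' Set.range x) = maximalIdeal (Localization.AtPrime 𝔔))
        (_ : (n : WithBot ℕ∞) = ringKrullDim (Localization.AtPrime 𝔔))
        (_ : ∀ m, m ∈ P ↔ Finsupp.weight a m = 0)
        (G : Set (Fin n →₀ ℕ)) (_ : G.Finite) (_ : (0 : Fin n →₀ ℕ) ∉ G) (_ : AddSubmonoid.closure G = P),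
        φ ⟨𝔔.comap (algebraMap (𝒮 0) S), inferInstance⟩ = t ∧
        ∀ (κ : Type) [Field κ],
          ∃ (b nx : ℕ) (xv : Fin nx → AddMonoidAlgebra κ ↥P) (_ : 𝕍[κ, P] ^ (b + 1) = Ideal.span (Set.range xv))
            (m : ℕ) (y : Fin m → AddMonoidAlgebra κ ↥P) (_ : ∀ j, y j ∈ 𝕍[κ, P] ^ (b + 1)) (N : ℕ)
            (_ : (𝕍[κ, P] ^ (b + 1)) ^ (N + 1) ≤ Ideal.span (Set.range y) * (𝕍[κ, P] ^ (b + 1)) ^ N),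
          ∀ j : Fin m, ∃ (G' : Set (blowupAlgebra (𝕍[κ, P] ^ (b + 1)) (y j)))
            (𝔪 : Ideal (blowupAlgebra (𝕍[κ, P] ^ (b + 1)) (y j)))
            (_ : 𝔪.IsMaximal) (M : ℕ),
            (∀ g ∈ G', IsRegularRing (Localization.Away g)) ∧
            𝔪 ^ M ≤ (𝕍[κ, P]).map (algebraMap _ (blowupAlgebra (𝕍[κ, P] ^ (b + 1)) (y j))) ⊔ Ideal.span G' ∧
            (¬ IsRegularLocalRing (Localization.AtPrime 𝔪) →
              Scheme.IsRegular (affineBlowup (R := Localization.AtPrime 𝔪) (maximalIdeal (Localization.AtPrime 𝔪))))) :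
    Scheme.HasResolution X := by
  refine hasResolution_of_isolated_fixedPoints_of_monoidAlgebra_certificate k X f hfin fun t ht => ?_
  -- `have` first: `obtain … := hchart t ht` would `generalize` and type-check the (heavy) goal — see the module docstring
  have hc := hchart t ht
  obtain ⟨k', ik, A, iA₁, iA₂, hA, S, iS₁, iS₂, 𝒮, i𝒮, iS₃, φ, iφ, 𝔔, i𝔔, hfix, n, x, a, P, hxa, hspan, hn, hP, G, hGfin, hG0,
    hGP, hφt, hmodel⟩ := hc
  -- the field-uniform package AT the residue field `κ(𝔮)` of the chart (again bound before destructuring)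
  have hm := hmodel (ResidueField (Localization.AtPrime (𝔔.comap (algebraMap (𝒮 0) S))))
  obtain ⟨b, nx, xv, hxv, m, y, hyJ, N, hred, hcert⟩ := hm
  exact ⟨k', ik, A, iA₁, iA₂, hA, S, iS₁, iS₂, 𝒮, i𝒮, iS₃, φ, iφ, 𝔔, i𝔔, hfix, n, x, a, P, hxa, hspan, hn, hP, G, hGfin, hG0, hGP,
    b, nx, xv, hxv, m, y, hyJ, N, hred, hφt, hcert⟩

end Summit.ResolutionOfSingularities.ResolutionOfSingularities.Theorems.FRationalResolution.MonoidAlgebraModel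

end
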